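import Summits.Ventures.PercRepro.S1TriangleKernelSixLemmas

/-!
# PercRepro — THE TRIANGLE KERNEL AT NULLITY `6`, CASE A (`|U| = 10`): THE CLASSIFICATION (p8, gen 24; S4 feeder)

`s₃ = 11` at nullity `6`, `m = 3` at `x`, `|U| = 10`: `Q = U ∖ St` has `3` points. Every `q ∈ Q` has a triangle meeting `Q`
only in `q` (pigeonhole on `Q ∖ {q}`), hence lies in a plane `P_ij = cl(Cᵢ ∪ Cⱼ)`; no `q` lies in two planes, no plane holds
two points of `Q` ((C2)); so no triangle avoiding `x` has exactly two points in `Q`, and each `q` is the `Q`-point of at most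
`2` triangles (they lie in the plane of `q`, using distinct points of `Cᵢ ∖ {x}`): `kernelSix_caseA_classify`. Axioms: standard.
-/

open scoped Matroid

namespace PercRepro

namespace S1

open Set

variable {α : Type}

/-- **CASE A, the classification**: with the three triangles `Cᵢ, Cⱼ, C_k` through `x` (all of them), every point of `U` on
`≥ 3` triangles, `8` triangles avoiding `x` and `|Q| = 3` (`Q = U ∖ St`): every triangle avoiding `x` meets `Q` in exactly
one point or equals `Q`, and each `q ∈ Q` is the `Q`-point of at most `2` of them. -/
theorem kernelSix_caseA_classify (M : Matroid α) [M.Finite]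
    (hC1 : ∀ L ⊆ M.E, M.eRk L = 2 → L.ncard ≤ 3)
    (hC2 : ∀ X ⊆ M.E, M.eRk X ≤ 3 → X.ncard ≤ 6) {x : α} (hx : M.IsNonloop x)
    {Ci Cj Ck : Set α} (hCi : Ci ∈ ThmN.trianglesThrough M x) (hCj : Cj ∈ ThmN.trianglesThrough M x)
    (hCk : Ck ∈ ThmN.trianglesThrough M x) (hij : Ci ≠ Cj) (hik : Ci ≠ Ck) (hjk : Cj ≠ Ck)
    (hmem3 : ∀ C, C ∈ ThmN.trianglesThrough M x → C = Ci ∨ C = Cj ∨ C = Ck)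
    (hmin3 : ∀ y ∈ ⋃₀ ThmN.triangles M, 3 ≤ (ThmN.trianglesThrough M y).ncard)
    (hS₂card : {C | M.IsCircuit C ∧ C.ncard = 3 ∧ x ∉ C}.ncard = 8)
    (hQ3 : ((⋃₀ ThmN.triangles M) \ ({x} ∪ (Ci ∪ Cj ∪ Ck))).ncard = 3) :
    (∀ T ∈ {C : Set α | M.IsCircuit C ∧ C.ncard = 3 ∧ x ∉ C},
        (∃ q ∈ ((⋃₀ ThmN.triangles M) \ ({x} ∪ (Ci ∪ Cj ∪ Ck))), T ∩ ((⋃₀ ThmN.triangles M) \ ({x} ∪ (Ci ∪ Cj ∪ Ck))) = {q}) ∨ T = ((⋃₀ ThmN.triangles M) \ ({x} ∪ (Ci ∪ Cj ∪ Ck)))) ∧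
    (∀ q ∈ ((⋃₀ ThmN.triangles M) \ ({x} ∪ (Ci ∪ Cj ∪ Ck))),
        {T | T ∈ {C : Set α | M.IsCircuit C ∧ C.ncard = 3 ∧ x ∉ C} ∧ T ∩ ((⋃₀ ThmN.triangles M) \ ({x} ∪ (Ci ∪ Cj ∪ Ck))) = {q}}.ncard ≤ 2) := by
  classical
  set S := ThmN.triangles M with hS
  have hSfin : S.Finite :=
    M.ground_finite.finite_subsets.subset (fun C hC => hC.1.subset_ground)
  have hUE : ⋃₀ S ⊆ M.E := by
    intro z hz
    obtain ⟨C, hC, hzC⟩ := Set.mem_sUnion.1 hz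
    exact hC.1.subset_ground hzC
  have hUfin : (⋃₀ S).Finite := M.ground_finite.subset hUE
  have hxU' : x ∈ ⋃₀ S := Set.mem_sUnion.2 ⟨Ci, ⟨hCi.1, hCi.2.1⟩, hCi.2.2⟩
  -- the star of `x`: `s = {C₁, C₂, C₃}`, `St` with `7` points and rank `≤ 4`
  set s : Finset (Set α) := {Ci, Cj, Ck} with hsdef
  have hs : ∀ C ∈ s, C ∈ ThmN.trianglesThrough M x := by
    intro C hC
    simp only [hsdef, Finset.mem_insert, Finset.mem_singleton] at hC
    rcases hC with rfl | rfl | rfl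
    · exact hCi
    · exact hCj
    · exact hCk
  have hscard : s.card = 3 := Finset.card_eq_three.2 ⟨Ci, Cj, Ck, hij, hik, hjk, rfl⟩
  obtain ⟨hstar_rk, hstar_card⟩ := ThmN.eRk_le_and_ncard_eq_of_triangles M hC1 hx s hs
  rw [hscard] at hstar_card hstar_rk
  set St := ({x} ∪ (Ci ∪ Cj ∪ Ck) : Set α) with hSt
  have hSteq : ({x} ∪ ⋃ C ∈ s, C) = St := by
    ext z
    constructor
    · intro hz
      rcases hz with hz | hz
      · exact Or.inl hz
      · obtain ⟨C, hC, hzC⟩ := Set.mem_iUnion₂.1 hz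
        simp only [hsdef, Finset.mem_insert, Finset.mem_singleton] at hC
        rcases hC with rfl | rfl | rfl
        · exact Or.inr (Or.inl (Or.inl hzC))
        · exact Or.inr (Or.inl (Or.inr hzC))
        · exact Or.inr (Or.inr hzC)
    · intro hz
      rcases hz with hz | hz
      · exact Or.inl hz
      · refine Or.inr ?_
        rcases hz with (hz | hz) | hz
        · exact Set.mem_iUnion₂.2 ⟨Ci, by simp [hsdef], hz⟩
        · exact Set.mem_iUnion₂.2 ⟨Cj, by simp [hsdef], hz⟩
        · exact Set.mem_iUnion₂.2 ⟨Ck, by simp [hsdef], hz⟩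
  rw [hSteq] at hstar_card hstar_rk
  have hStU : St ⊆ ⋃₀ S := by
    intro z hz
    rcases hz with hz | hz
    · rw [Set.mem_singleton_iff.1 hz]; exact hxU'
    · rcases hz with (hz | hz) | hz
      · exact Set.mem_sUnion.2 ⟨Ci, ⟨hCi.1, hCi.2.1⟩, hz⟩
      · exact Set.mem_sUnion.2 ⟨Cj, ⟨hCj.1, hCj.2.1⟩, hz⟩
      · exact Set.mem_sUnion.2 ⟨Ck, ⟨hCk.1, hCk.2.1⟩, hz⟩
  have hStE : St ⊆ M.E := hStU.trans hUE
  have hStfin : St.Finite := hUfin.subset hStU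
  set Q := (⋃₀ S) \ St with hQ
  have hQfin : Q.Finite := hUfin.subset Set.sdiff_subset
  have hQSt : ∀ q ∈ Q, q ∉ St := fun q hq => hq.2
  have hQU : ∀ q ∈ Q, q ∈ ⋃₀ S := fun q hq => hq.1
  have hQE : ∀ q ∈ Q, q ∈ M.E := fun q hq => hUE hq.1
  -- every triangle lies in `U`; a triangle through a point off the star avoids `x`
  have hTU : ∀ T ∈ S, T ⊆ ⋃₀ S := fun T hT z hz => Set.mem_sUnion.2 ⟨T, hT, hz⟩
  have hTx : ∀ {y : α}, y ∉ St → ∀ T ∈ ThmN.trianglesThrough M y, x ∉ T := by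
    intro y hy T hT hxT
    apply hy
    rcases hmem3 T ⟨hT.1, hT.2.1, hxT⟩ with rfl | rfl | rfl
    · exact Or.inr (Or.inl (Or.inl hT.2.2))
    · exact Or.inr (Or.inl (Or.inr hT.2.2))
    · exact Or.inr (Or.inr hT.2.2)
  -- the eight triangles avoiding `x`
  set S₂ := {C | M.IsCircuit C ∧ C.ncard = 3 ∧ x ∉ C} with hS₂
  have hS₂fin : S₂.Finite := hSfin.subset (fun C hC => ⟨hC.1, hC.2.1⟩)
  have hS₂S : ∀ T ∈ S₂, T ∈ S := fun T hT => ⟨hT.1, hT.2.1⟩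
  have hS₂x : ∀ T ∈ S₂, x ∉ T := fun T hT => hT.2.2
  -- every triangle avoiding `x` has a point in `Q`
  have hQpt : ∀ T ∈ S₂, ∃ q ∈ T, q ∈ Q := by
    intro T hT
    obtain ⟨q, hqT, hqSt⟩ := exists_mem_notMem_star_of_notMem M hC1 hC2 hx hCi hCj hCk hij hik hjk
      (hS₂S T hT) (hS₂x T hT)
    exact ⟨q, hqT, hTU T (hS₂S T hT) hqT, hqSt⟩
  -- no two distinct points of `Q` lie in one plane
  have hA3 : ∀ {X : Set α}, (X = Ci ∪ Cj ∨ X = Ci ∪ Ck ∨ X = Cj ∪ Ck) → ∀ q ∈ Q, ∀ q' ∈ Q, q ≠ q' →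
      q ∈ M.closure X → q' ∈ M.closure X → False := by
    intro X hX q hq q' hq' hqq' hqX hq'X
    have hoff : ∀ z ∈ Q, z ∉ X := by
      intro z hz hzX
      apply hQSt z hz
      rcases hX with rfl | rfl | rfl
      · rcases hzX with h | h
        · exact Or.inr (Or.inl (Or.inl h))
        · exact Or.inr (Or.inl (Or.inr h))
      · rcases hzX with h | h
        · exact Or.inr (Or.inl (Or.inl h))
        · exact Or.inr (Or.inr h)
      · rcases hzX with h | h
        · exact Or.inr (Or.inl (Or.inr h))
        · exact Or.inr (Or.inr h)
    rcases hX with rfl | rfl | rfl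
    · exact false_of_two_mem_closure_union_trianglesThrough M hC1 hC2 hx hCi hCj hij hqq' (hQE q hq)
        (hQE q' hq') (hoff q hq) (hoff q' hq') hqX hq'X
    · exact false_of_two_mem_closure_union_trianglesThrough M hC1 hC2 hx hCi hCk hik hqq' (hQE q hq)
        (hQE q' hq') (hoff q hq) (hoff q' hq') hqX hq'X
    · exact false_of_two_mem_closure_union_trianglesThrough M hC1 hC2 hx hCj hCk hjk hqq' (hQE q hq)
        (hQE q' hq') (hoff q hq) (hoff q' hq') hqX hq'X
  -- no point of `Q` lies in two planes
  have hA2 : ∀ q ∈ Q, ¬ (q ∈ M.closure (Ci ∪ Cj) ∧ q ∈ M.closure (Ci ∪ Ck)) ∧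
      ¬ (q ∈ M.closure (Ci ∪ Cj) ∧ q ∈ M.closure (Cj ∪ Ck)) ∧
      ¬ (q ∈ M.closure (Ci ∪ Ck) ∧ q ∈ M.closure (Cj ∪ Ck)) := by
    intro q hq
    have hqi : q ∉ Ci := fun h => hQSt q hq (Or.inr (Or.inl (Or.inl h)))
    have hqj : q ∉ Cj := fun h => hQSt q hq (Or.inr (Or.inl (Or.inr h)))
    have hqk : q ∉ Ck := fun h => hQSt q hq (Or.inr (Or.inr h))
    refine ⟨fun h => ?_, fun h => ?_, fun h => ?_⟩
    · exact false_of_mem_closure_union_of_mem_closure_union M hC1 hC2 hx hCi hCj hCk hij hik hjk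
        (hQE q hq) hqi h.1 h.2
    · refine false_of_mem_closure_union_of_mem_closure_union M hC1 hC2 hx hCj hCi hCk hij.symm hjk hik
        (hQE q hq) hqj ?_ h.2
      rw [Set.union_comm]; exact h.1
    · refine false_of_mem_closure_union_of_mem_closure_union M hC1 hC2 hx hCk hCi hCj hik.symm hjk.symm hij
        (hQE q hq) hqk ?_ ?_
      · rw [Set.union_comm]; exact h.1
      · rw [Set.union_comm]; exact h.2
  -- the two-star trichotomy: a triangle through `q` whose other points are in the star puts `q` in a plane
  have htri : ∀ q ∈ Q, ∀ T ∈ ThmN.trianglesThrough M q, (∀ y ∈ T, y ≠ q → y ∈ St) →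
      (q ∈ M.closure (Ci ∪ Cj) ∧ (T ∩ Ci).Nonempty ∧ (T ∩ Cj).Nonempty) ∨
      (q ∈ M.closure (Ci ∪ Ck) ∧ (T ∩ Ci).Nonempty ∧ (T ∩ Ck).Nonempty) ∨
      (q ∈ M.closure (Cj ∪ Ck) ∧ (T ∩ Cj).Nonempty ∧ (T ∩ Ck).Nonempty) := by
    intro q hq T hT hother
    have hxT : x ∉ T := hTx (hQSt q hq) T hT
    obtain ⟨C, hCm, C', hC'm, hCC', hTC, hTC', hqcl⟩ :=
      exists_pair_closure_of_forall_mem_star M hC1 hCi hCj hCk ⟨hT.1, hT.2.1⟩ hxT hT.2.2 hother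
    rcases hCm with rfl | rfl | rfl <;> rcases hC'm with rfl | rfl | rfl
    · exact absurd rfl hCC'
    · exact Or.inl ⟨hqcl, hTC, hTC'⟩
    · exact Or.inr (Or.inl ⟨hqcl, hTC, hTC'⟩)
    · exact Or.inl ⟨by rw [Set.union_comm]; exact hqcl, hTC', hTC⟩
    · exact absurd rfl hCC'
    · exact Or.inr (Or.inr ⟨hqcl, hTC, hTC'⟩)
    · exact Or.inr (Or.inl ⟨by rw [Set.union_comm]; exact hqcl, hTC', hTC⟩)
    · exact Or.inr (Or.inr ⟨by rw [Set.union_comm]; exact hqcl, hTC', hTC⟩)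
    · exact absurd rfl hCC'
  -- a triangle through `q` lies in the closure of `q` and a star point in the plane of `q`
  have hclT : ∀ q ∈ Q, ∀ T ∈ ThmN.trianglesThrough M q, ∀ {X : Set α}, X ⊆ St → q ∈ M.closure X →
      ∀ a ∈ T, a ∈ X → T ⊆ M.closure X := by
    intro q hq T hT X hXSt hqX a haT haX
    have haq : a ≠ q := fun h => hQSt q hq (hXSt (h ▸ haX))
    refine (triangle_subset_closure_of_two_mem M ⟨hT.1, hT.2.1⟩ haT hT.2.2 haq).trans ?_
    refine M.closure_subset_closure_of_subset_closure ?_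
    intro z hz
    rcases hz with rfl | hz
    · exact M.subset_closure X (hXSt.trans hStE) haX
    · rw [Set.mem_singleton_iff.1 hz]; exact hqX
  -- the triangles avoiding `x` as a finset
  set S₂f : Finset (Set α) := hS₂fin.toFinset with hS₂fdef
  have hmemS₂ : ∀ T, T ∈ S₂f ↔ T ∈ S₂ := fun T => Set.Finite.mem_toFinset hS₂fin
  have hS₂fcard : S₂f.card = 8 := by
    rw [hS₂fdef, ← Set.ncard_eq_toFinset_card _ hS₂fin, hS₂card]
  have hStcl' : St ⊆ M.closure St := M.subset_closure St hStE
  -- (A1) every point of `Q` lies in a plane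
  have hplane : ∀ q ∈ Q, q ∈ M.closure (Ci ∪ Cj) ∨ q ∈ M.closure (Ci ∪ Ck) ∨ q ∈ M.closure (Cj ∪ Ck) := by
    intro q hq
    have hTqfin : (ThmN.trianglesThrough M q).Finite := hSfin.subset (fun C hC => ⟨hC.1, hC.2.1⟩)
    set 𝒯 : Finset (Set α) := hTqfin.toFinset with h𝒯def
    have hmemq : ∀ T, T ∈ 𝒯 ↔ T ∈ ThmN.trianglesThrough M q := fun T => Set.Finite.mem_toFinset hTqfin
    have hcardq : 3 ≤ 𝒯.card := by
      rw [h𝒯def, ← Set.ncard_eq_toFinset_card _ hTqfin]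
      exact hmin3 q (hQU q hq)
    have hDfin : (Q \ {q}).Finite := hQfin.subset Set.sdiff_subset
    set K : Finset α := hDfin.toFinset with hKdef
    have hKcard : K.card = 2 := by
      rw [hKdef, ← Set.ncard_eq_toFinset_card _ hDfin,
        Set.ncard_sdiff' (Set.singleton_subset_iff.2 hq) hQfin, hQ3, Set.ncard_singleton]
    have hqD : q ∉ Q \ {q} := fun h => h.2 (Set.mem_singleton q)
    have hK : ∀ T ∈ 𝒯, T ∩ (Q \ {q}) ⊆ ↑K := by
      intro T _ z hz
      rw [hKdef, Set.Finite.coe_toFinset]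
      exact hz.2
    obtain ⟨T, hT𝒯, hTD⟩ := exists_triangle_disjoint_of_card_lt M hC1 𝒯 (fun T hT => (hmemq T).1 hT) hqD K hK
      (by omega)
    have hT : T ∈ ThmN.trianglesThrough M q := (hmemq T).1 hT𝒯
    have hother : ∀ y ∈ T, y ≠ q → y ∈ St := by
      intro y hy hyq
      by_contra hySt
      have hyQ : y ∈ Q \ {q} :=
        ⟨⟨hTU T ⟨hT.1, hT.2.1⟩ hy, hySt⟩, fun h => hyq (Set.mem_singleton_iff.1 h)⟩
      have : y ∈ T ∩ (Q \ {q}) := ⟨hy, hyQ⟩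
      rw [hTD] at this
      exact this
    rcases htri q hq T hT hother with ⟨h, -, -⟩ | ⟨h, -, -⟩ | ⟨h, -, -⟩
    · exact Or.inl h
    · exact Or.inr (Or.inl h)
    · exact Or.inr (Or.inr h)
  -- the three planes' unions lie in the star
  have hsubij : Ci ∪ Cj ⊆ St := fun z hz => Or.inr (Or.inl hz)
  have hsubik : Ci ∪ Ck ⊆ St :=
    fun _ hz => hz.elim (fun h => Or.inr (Or.inl (Or.inl h))) (fun h => Or.inr (Or.inr h))
  have hsubjk : Cj ∪ Ck ⊆ St :=
    fun _ hz => hz.elim (fun h => Or.inr (Or.inl (Or.inr h))) (fun h => Or.inr (Or.inr h))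
  -- (A4) no triangle avoiding `x` has exactly two points in `Q`
  have hA4 : ∀ T ∈ S₂, ∀ q ∈ T, q ∈ Q → ∀ q' ∈ T, q' ∈ Q → q ≠ q' → ∀ a ∈ T, a ∉ Q → False := by
    intro T hT q hqT hq q' hq'T hq' hqq' a haT haQ
    have haU : a ∈ ⋃₀ S := hTU T (hS₂S T hT) haT
    have haSt : a ∈ St := by
      by_contra h
      exact haQ ⟨haU, h⟩
    have hax : a ≠ x := fun h => hS₂x T hT (h ▸ haT)
    have hTq : T ∈ ThmN.trianglesThrough M q := ⟨hT.1, hT.2.1, hqT⟩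
    have hTq' : T ∈ ThmN.trianglesThrough M q' := ⟨hT.1, hT.2.1, hq'T⟩
    have haC : a ∈ Ci ∪ Cj ∪ Ck := by
      rcases haSt with h | h
      · exact absurd (Set.mem_singleton_iff.1 h) hax
      · exact h
    have hstep : ∀ {X : Set α}, (X = Ci ∪ Cj ∨ X = Ci ∪ Ck ∨ X = Cj ∪ Ck) → X ⊆ St →
        q ∈ M.closure X → a ∈ X → False := by
      intro X hX hXSt hqX haX
      have := hclT q hq T hTq hXSt hqX a haT haX hq'T
      exact hA3 hX q hq q' hq' hqq' hqX this
    have hstep' : ∀ {X : Set α}, (X = Ci ∪ Cj ∨ X = Ci ∪ Ck ∨ X = Cj ∪ Ck) → X ⊆ St →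
        q' ∈ M.closure X → a ∈ X → False := by
      intro X hX hXSt hq'X haX
      have := hclT q' hq' T hTq' hXSt hq'X a haT haX hqT
      exact hA3 hX q' hq' q hq hqq'.symm hq'X this
    rcases hplane q hq with hq1 | hq1 | hq1 <;> rcases hplane q' hq' with hq2 | hq2 | hq2
    · exact hA3 (Or.inl rfl) q hq q' hq' hqq' hq1 hq2
    · rcases haC with (h | h) | h
      · exact hstep (Or.inl rfl) hsubij hq1 (Or.inl h)
      · exact hstep (Or.inl rfl) hsubij hq1 (Or.inr h)
      · exact hstep' (Or.inr (Or.inl rfl)) hsubik hq2 (Or.inr h)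
    · rcases haC with (h | h) | h
      · exact hstep (Or.inl rfl) hsubij hq1 (Or.inl h)
      · exact hstep (Or.inl rfl) hsubij hq1 (Or.inr h)
      · exact hstep' (Or.inr (Or.inr rfl)) hsubjk hq2 (Or.inr h)
    · rcases haC with (h | h) | h
      · exact hstep (Or.inr (Or.inl rfl)) hsubik hq1 (Or.inl h)
      · exact hstep' (Or.inl rfl) hsubij hq2 (Or.inr h)
      · exact hstep (Or.inr (Or.inl rfl)) hsubik hq1 (Or.inr h)
    · exact hA3 (Or.inr (Or.inl rfl)) q hq q' hq' hqq' hq1 hq2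
    · rcases haC with (h | h) | h
      · exact hstep (Or.inr (Or.inl rfl)) hsubik hq1 (Or.inl h)
      · exact hstep' (Or.inr (Or.inr rfl)) hsubjk hq2 (Or.inl h)
      · exact hstep (Or.inr (Or.inl rfl)) hsubik hq1 (Or.inr h)
    · rcases haC with (h | h) | h
      · exact hstep' (Or.inl rfl) hsubij hq2 (Or.inl h)
      · exact hstep (Or.inr (Or.inr rfl)) hsubjk hq1 (Or.inl h)
      · exact hstep (Or.inr (Or.inr rfl)) hsubjk hq1 (Or.inr h)
    · rcases haC with (h | h) | h
      · exact hstep' (Or.inr (Or.inl rfl)) hsubik hq2 (Or.inl h)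
      · exact hstep (Or.inr (Or.inr rfl)) hsubjk hq1 (Or.inl h)
      · exact hstep (Or.inr (Or.inr rfl)) hsubjk hq1 (Or.inr h)
    · exact hA3 (Or.inr (Or.inr rfl)) q hq q' hq' hqq' hq1 hq2
  -- (A5) through each `q ∈ Q` pass at most two triangles meeting `Q` only in `q`
  have hA5 : ∀ q ∈ Q, (S₂f.filter (fun T => T ∩ Q = {q})).card ≤ 2 := by
    intro q hq
    by_contra hgt
    push Not at hgt
    obtain ⟨𝒯, h𝒯sub, h𝒯card⟩ :=
      Finset.exists_subset_card_eq (show 3 ≤ (S₂f.filter (fun T => T ∩ Q = {q})).card by omega)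
    have h𝒯 : ∀ T ∈ 𝒯, T ∈ S₂ ∧ T ∩ Q = {q} := by
      intro T hT
      have := h𝒯sub hT
      rw [Finset.mem_filter, hmemS₂] at this
      exact this
    have h𝒯q : ∀ T ∈ 𝒯, T ∈ ThmN.trianglesThrough M q := by
      intro T hT
      obtain ⟨hTS₂, hTQ⟩ := h𝒯 T hT
      refine ⟨hTS₂.1, hTS₂.2.1, ?_⟩
      have : q ∈ T ∩ Q := by rw [hTQ]; exact Set.mem_singleton q
      exact this.1
    have hother : ∀ T ∈ 𝒯, ∀ y ∈ T, y ≠ q → y ∈ St := by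
      intro T hT y hy hyq
      by_contra hySt
      have hyQ : y ∈ T ∩ Q := ⟨hy, hTU T (hS₂S T (h𝒯 T hT).1) hy, hySt⟩
      rw [(h𝒯 T hT).2] at hyQ
      exact hyq (Set.mem_singleton_iff.1 hyQ)
    obtain ⟨T₀, hT₀⟩ : 𝒯.Nonempty := Finset.card_pos.1 (by omega)
    have hqi : q ∉ Ci := fun h => hQSt q hq (Or.inr (Or.inl (Or.inl h)))
    have hqj : q ∉ Cj := fun h => hQSt q hq (Or.inr (Or.inl (Or.inr h)))
    obtain ⟨hA2a, hA2b, hA2c⟩ := hA2 q hq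
    -- every `T ∈ 𝒯` meets the same triangle `D` through `x`
    have hmeet : ∃ D ∈ ThmN.trianglesThrough M x, q ∉ D ∧ ∀ T ∈ 𝒯, (T ∩ D).Nonempty := by
      rcases htri q hq T₀ (h𝒯q T₀ hT₀) (hother T₀ hT₀) with ⟨h0, -, -⟩ | ⟨h0, -, -⟩ | ⟨h0, -, -⟩
      · refine ⟨Ci, hCi, hqi, fun T hT => ?_⟩
        rcases htri q hq T (h𝒯q T hT) (hother T hT) with ⟨-, h, -⟩ | ⟨-, h, -⟩ | ⟨h, -, -⟩
        · exact h
        · exact h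
        · exact absurd ⟨h0, h⟩ hA2b
      · refine ⟨Ci, hCi, hqi, fun T hT => ?_⟩
        rcases htri q hq T (h𝒯q T hT) (hother T hT) with ⟨-, h, -⟩ | ⟨-, h, -⟩ | ⟨h, -, -⟩
        · exact h
        · exact h
        · exact absurd ⟨h0, h⟩ hA2c
      · refine ⟨Cj, hCj, hqj, fun T hT => ?_⟩
        rcases htri q hq T (h𝒯q T hT) (hother T hT) with ⟨h, -, -⟩ | ⟨h, -, -⟩ | ⟨-, h, -⟩
        · exact absurd ⟨h, h0⟩ hA2b
        · exact absurd ⟨h, h0⟩ hA2c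
        · exact h
    obtain ⟨D, hD, hqD, hmeetD⟩ := hmeet
    have hDfin : D.Finite := M.ground_finite.subset hD.1.subset_ground
    have hD'fin : (D \ {x}).Finite := hDfin.subset Set.sdiff_subset
    set K : Finset α := hD'fin.toFinset with hKdef
    have hKcard : K.card = 2 := by
      rw [hKdef, ← Set.ncard_eq_toFinset_card _ hD'fin,
        Set.ncard_sdiff' (Set.singleton_subset_iff.2 hD.2.2) hDfin, hD.2.1, Set.ncard_singleton]
    have hK : ∀ T ∈ 𝒯, T ∩ D ⊆ ↑K := by
      intro T hT z hz
      rw [hKdef, Set.Finite.coe_toFinset]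
      refine ⟨hz.2, ?_⟩
      intro hzx
      rw [Set.mem_singleton_iff.1 hzx] at hz
      exact hS₂x T (h𝒯 T hT).1 hz.1
    obtain ⟨T, hT, hTD⟩ := exists_triangle_disjoint_of_card_lt M hC1 𝒯 h𝒯q hqD K hK (by omega)
    have := hmeetD T hT
    rw [hTD] at this
    exact Set.not_nonempty_empty this
  refine ⟨?_, ?_⟩
  · -- the classification of the triangles avoiding `x`
    intro T hTS₂
    have hTfin : T.Finite := M.ground_finite.subset hTS₂.1.subset_ground
    obtain ⟨q, hqT, hqQ⟩ := hQpt T hTS₂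
    have hTQfin : (T ∩ Q).Finite := hTfin.subset Set.inter_subset_left
    have hTQle : (T ∩ Q).ncard ≤ 3 := by
      have := Set.ncard_le_ncard (Set.inter_subset_left : T ∩ Q ⊆ T) hTfin
      rw [hTS₂.2.1] at this
      exact this
    have hTQpos : 1 ≤ (T ∩ Q).ncard :=
      Nat.one_le_iff_ne_zero.2 (fun h => by
        rw [Set.ncard_eq_zero hTQfin] at h
        exact (h ▸ (⟨hqT, hqQ⟩ : q ∈ T ∩ Q) : q ∈ (∅ : Set α)))
    rcases (show (T ∩ Q).ncard = 1 ∨ (T ∩ Q).ncard = 2 ∨ (T ∩ Q).ncard = 3 by omega) with h1 | h2 | h3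
    · obtain ⟨q₁, hq₁⟩ := Set.ncard_eq_one.1 h1
      have hq₁Q : q₁ ∈ Q := by
        have : q₁ ∈ T ∩ Q := by rw [hq₁]; exact Set.mem_singleton q₁
        exact this.2
      exact Or.inl ⟨q₁, hq₁Q, hq₁⟩
    · exfalso
      obtain ⟨q₁, q₂, hq₁₂, hq₁₂eq⟩ := Set.ncard_eq_two.1 h2
      have hq₁ : q₁ ∈ T ∩ Q := by rw [hq₁₂eq]; exact Or.inl rfl
      have hq₂ : q₂ ∈ T ∩ Q := by rw [hq₁₂eq]; exact Or.inr rfl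
      have hstarpt : ∃ a ∈ T, a ∉ Q := by
        by_contra h
        push Not at h
        have hTsub : T ⊆ T ∩ Q := fun z hz => ⟨hz, h z hz⟩
        have := Set.ncard_le_ncard hTsub hTQfin
        rw [h2, hTS₂.2.1] at this
        omega
      obtain ⟨a, haT, haQ⟩ := hstarpt
      exact hA4 T hTS₂ q₁ hq₁.1 hq₁.2 q₂ hq₂.1 hq₂.2 hq₁₂ a haT haQ
    · refine Or.inr ?_
      have hTQ : T ∩ Q = T :=
        Set.eq_of_subset_of_ncard_le Set.inter_subset_left (by rw [h3, hTS₂.2.1]) hTfin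
      have hTsub : T ⊆ Q := by rw [← hTQ]; exact Set.inter_subset_right
      exact Set.eq_of_subset_of_ncard_le hTsub (by rw [hQ3, hTS₂.2.1]) hQfin
  · -- the two-star bound, as a set
    intro q hq
    have hset : {T | T ∈ S₂ ∧ T ∩ Q = {q}} = ↑(S₂f.filter (fun T => T ∩ Q = {q})) := by
      ext T
      simp only [Set.mem_setOf_eq, Finset.coe_filter, hmemS₂]
    rw [hset, Set.ncard_coe_finset]
    exact hA5 q hq

end S1

end PercRepro
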